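import Summits.Ventures.PercRepro.Night2LocalRuleHybrid
import Summits.Ventures.PercRepro.Night2ExcessLoss

/-!
# PercRepro — the COMPLETION shares of the hybrid rule (night-2, gen 28)

A third concrete share function for `localShadowHall_of_hybrid`: the loss of a `P`-pair `(B, z)` at its covering set
`Q = B ∪ {z}` is split equally over the **completion targets** `Q ∪ {y}`, `y` ranging over the points of a fixed set
`X ⊆ G` outside `Q`.  In the `(2, 1)` two-fat-closure cell `X` is the set of the four off-plane points: a lossy big
covering set carries one point of each class, its two completion targets complete one class each, and a target
receives load from at most two covering sets (`Night2TwoOneColumn`).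

* `compTargets X B z` — the sets `B ∪ {z, y}`, `y ∈ X ∖ (B ∪ {z})`; `dshComp` — the equal split of the loss;
* `mem_compTargets`, `compTargets_subset_shadowAt`, `card_compTargets` (`= |X ∖ (B ∪ {z})|`);
* `dshComp_nonneg`, `dshComp_supp`, `dshComp_row` (the shares sum to the loss when a target exists);
* **`localShadowHall_of_comp`**: `localShadowHall_of_hybrid` with `dsh := dshComp`;
* `faceLossP` (the face loss restricted to the `P`-faces) and **`dload_comp_le_sum_faceLossP`**: the load of `S` is at
  most `Σ_{y ∈ X ∩ S} (Σ_{w ∈ S ∖ y} faceLossP (S ∖ y) w) / |X ∖ (S ∖ y)|`.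
-/

namespace PercRepro.Shadow

open Finset PerFlat ThmH

variable {α : Type*} [DecidableEq α] {M : Matroid α} [M.Finite]

section Comp

variable (M) (q : ℕ) (G : Finset α)

/-- The completion targets of the pair `(B, z)` along `X`: the sets `B ∪ {z, y}` for `y ∈ X ∖ (B ∪ {z})`. -/
noncomputable def compTargets (X B : Finset α) (z : α) : Finset (Finset α) :=
  (X \ insert z B).image (fun y => insert y (insert z B))

/-- The equal split of the loss of `(B, z)` over its completion targets along `X`. -/
noncomputable def dshComp (X B : Finset α) (z : α) (S : Finset α) : ℚ :=
  if S ∈ compTargets X B z then loss M q G B z / ((compTargets X B z).card : ℚ) else 0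

variable (P : Finset α → Prop) [DecidablePred P]

open scoped Classical in
/-- The loss of the face `Q ∖ w` of `Q` at `w` when that face is a thin `P`-member with `w ∉ cl (Q ∖ w)`. -/
noncomputable def faceLossP (Q : Finset α) (w : α) : ℚ :=
  if Q.erase w ∈ thinMembers M q G ∧ P (Q.erase w) ∧ w ∈ G \ clF M (Q.erase w) then loss M q G (Q.erase w) w else 0

end Comp

section CompLemmas

variable {q : ℕ} {G : Finset α}

/-- Membership in `compTargets`. -/
theorem mem_compTargets {X B S : Finset α} {z : α} :
    S ∈ compTargets X B z ↔ ∃ y ∈ X \ insert z B, insert y (insert z B) = S := by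
  unfold compTargets
  rw [Finset.mem_image]

/-- The completion targets of a pair of a member inside `G` along `X ⊆ G` are shadow sets. -/
theorem compTargets_subset_shadowAt (hG : G ∈ flatsQ M (q + 1)) {X : Finset α} (hX : X ⊆ G) {B : Finset α}
    (hB : B ∈ membersIn M (Uq M (q + 2) q) G) {z : α} (hz : z ∈ G \ clF M B) :
    compTargets X B z ⊆ shadowAt M (q + 2) q (Uq M (q + 2) q) G := by
  intro S hS
  obtain ⟨y, hy, rfl⟩ := mem_compTargets.1 hS
  have hBG : clF M B ⊆ G := (mem_membersIn.1 hB).2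
  have hBU : B ∈ Uq M (q + 2) q := (mem_membersIn.1 hB).1
  have hBsub : B ⊆ G := (subset_clF hBU).trans hBG
  exact superset_mem_shadowAt hG hB hz (Finset.subset_insert y _)
    (Finset.insert_subset (hX (Finset.mem_sdiff.1 hy).1)
      (Finset.insert_subset (Finset.mem_sdiff.1 hz).1 hBsub))

/-- `#compTargets X B z = |X ∖ (B ∪ {z})|`. -/
theorem card_compTargets (X B : Finset α) (z : α) : (compTargets X B z).card = (X \ insert z B).card := by
  unfold compTargets
  apply Finset.card_image_of_injOn
  intro x hx y hy hxy
  rw [Finset.mem_coe, Finset.mem_sdiff] at hx hy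
  dsimp only at hxy
  have h1 : x ∈ insert y (insert z B) := by
    rw [← hxy]; exact Finset.mem_insert_self x _
  rw [Finset.mem_insert] at h1
  rcases h1 with h1 | h1
  · exact h1
  · exact absurd h1 hx.2

/-- The completion shares are nonnegative. -/
theorem dshComp_nonneg (hG : G ∈ flatsQ M (q + 1)) (hd : (gr M \ G).card ≤ q) (X B : Finset α) (z : α)
    (S : Finset α) : 0 ≤ dshComp M q G X B z S := by
  unfold dshComp
  split_ifs
  · exact div_nonneg (loss_nonneg' hG hd B z) (by positivity)
  · exact le_refl _

/-- The completion shares are supported on the supersets of `B ∪ {z}`. -/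
theorem dshComp_supp (X B : Finset α) (z : α) (S : Finset α) (h : dshComp M q G X B z S ≠ 0) :
    insert z B ⊆ S := by
  unfold dshComp at h
  split_ifs at h with hS
  · obtain ⟨y, -, rfl⟩ := mem_compTargets.1 hS
    exact Finset.subset_insert y _
  · exact absurd rfl h

open scoped Classical in
/-- The completion shares of a pair sum to its loss when a target exists (or the loss is zero). -/
theorem dshComp_row (hG : G ∈ flatsQ M (q + 1)) {X : Finset α} (hX : X ⊆ G) {B : Finset α}
    (hB : B ∈ membersIn M (Uq M (q + 2) q) G) {z : α} (hz : z ∈ G \ clF M B)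
    (hne : loss M q G B z ≠ 0 → (X \ insert z B).Nonempty) :
    ∑ S ∈ shadowAt M (q + 2) q (Uq M (q + 2) q) G, dshComp M q G X B z S = loss M q G B z := by
  unfold dshComp
  rw [← Finset.sum_filter, Finset.filter_mem_eq_inter,
    Finset.inter_eq_right.2 (compTargets_subset_shadowAt hG hX hB hz), Finset.sum_const, nsmul_eq_mul]
  by_cases hl : loss M q G B z = 0
  · rw [hl]; ring
  · have hpos : (0 : ℚ) < ((compTargets X B z).card : ℚ) := by
      rw [card_compTargets]
      exact_mod_cast Finset.card_pos.2 (hne hl)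
    field_simp

open scoped Classical in
/-- **The local form from the hybrid rule with the completion shares**: (LI_G) follows from (i) every lossy `P`-pair
has a completion target, (ii) the column bound `dload S ≤ cap2 S` at every shadow set, (iii) the per-loss inequality of
the non-`P` pairs with the capacities `cap3`. -/
theorem localShadowHall_of_comp {P : Finset α → Prop} [DecidablePred P] (hG : G ∈ flatsQ M (q + 1))
    (hd : (gr M \ G).card ≤ q) {X : Finset α} (hX : X ⊆ G)
    (hne : ∀ B ∈ thinMembers M q G, P B → ∀ z ∈ G \ clF M B, loss M q G B z ≠ 0 → (X \ insert z B).Nonempty)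
    (hdl : ∀ S ∈ shadowAt M (q + 2) q (Uq M (q + 2) q) G, dload M q G P (dshComp M q G X) S ≤ cap2 M q G S)
    (hcond : ∀ B ∈ thinMembers M q G, ¬ P B → ∀ z ∈ G \ clF M B,
      loss M q G B z ≤ rhoL M q G B z * lossIncomeH M q G P (dshComp M q G X) B z) :
    LocalShadowHall M q G :=
  localShadowHall_of_hybrid hG hd (dshComp_nonneg hG hd X) (dshComp_supp X)
    (fun B hB hP z hz => dshComp_row hG hX (mem_thinMembers.1 hB).1 hz (hne B hB hP z hz)) hdl hcond

/-! ## The load through the faces -/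

variable {P : Finset α → Prop} [DecidablePred P]

open scoped Classical in
/-- The `P`-face loss is at most the face loss. -/
theorem faceLossP_le_faceLoss (hG : G ∈ flatsQ M (q + 1)) (hd : (gr M \ G).card ≤ q) (Q : Finset α) (w : α) :
    faceLossP M q G P Q w ≤ faceLoss M q G Q w := by
  unfold faceLossP faceLoss
  split_ifs with h1 h2
  · exact le_refl _
  · exact absurd ⟨h1.1, h1.2.2⟩ h2
  · exact loss_nonneg' hG hd _ _
  · exact le_refl _

open scoped Classical in
/-- The `P`-face losses are nonnegative. -/
theorem faceLossP_nonneg (hG : G ∈ flatsQ M (q + 1)) (hd : (gr M \ G).card ≤ q) (Q : Finset α) (w : α) :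
    0 ≤ faceLossP M q G P Q w := by
  unfold faceLossP
  split_ifs
  · exact loss_nonneg' hG hd _ _
  · exact le_refl _

open scoped Classical in
/-- A completion share of `(B, z)` at `S` is a sum over the points `y ∈ X ∩ S` with `S ∖ y = B ∪ {z}`. -/
theorem dshComp_eq_sum (X B : Finset α) (z : α) (S : Finset α) :
    dshComp M q G X B z S = ∑ y ∈ X ∩ S,
      if S.erase y = insert z B then loss M q G B z / ((X \ S.erase y).card : ℚ) else 0 := by
  unfold dshComp
  split_ifs with hS
  · obtain ⟨y₀, hy₀, rfl⟩ := mem_compTargets.1 hS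
    rw [Finset.mem_sdiff] at hy₀
    have hy₀S : y₀ ∈ X ∩ insert y₀ (insert z B) := Finset.mem_inter.2 ⟨hy₀.1, Finset.mem_insert_self _ _⟩
    have hkey : (insert y₀ (insert z B)).erase y₀ = insert z B := Finset.erase_insert hy₀.2
    rw [Finset.sum_eq_single y₀]
    · rw [if_pos hkey, hkey, card_compTargets]
    · intro y hy hne
      rw [if_neg]
      intro h
      apply hne
      have h1 : y ∈ insert y₀ (insert z B) := (Finset.mem_inter.1 hy).2
      have h2 : y ∉ (insert y₀ (insert z B)).erase y := Finset.notMem_erase y _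
      rw [h] at h2
      rw [Finset.mem_insert] at h1
      rcases h1 with h1 | h1
      · exact h1
      · exact absurd h1 h2
    · intro h; exact absurd hy₀S h
  · symm
    apply Finset.sum_eq_zero
    intro y hy
    rw [if_neg]
    intro h
    apply hS
    rw [mem_compTargets]
    refine ⟨y, Finset.mem_sdiff.2 ⟨(Finset.mem_inter.1 hy).1, ?_⟩, ?_⟩
    · rw [← h]; exact Finset.notMem_erase y S
    · rw [← h]; exact Finset.insert_erase (Finset.mem_inter.1 hy).2

open scoped Classical in
/-- The `P`-losses of the pairs whose covering set is `Q` sum to the `P`-face losses of `Q`. -/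
theorem sum_loss_of_insert_eq (Q : Finset α) :
    ∑ B ∈ (thinMembers M q G).filter P, ∑ z ∈ G \ clF M B,
      (if insert z B = Q then loss M q G B z else 0) = ∑ w ∈ Q, faceLossP M q G P Q w := by
  -- reindex the inner sums by the inserted point
  have hstep : ∀ B ∈ (thinMembers M q G).filter P, ∑ z ∈ G \ clF M B, (if insert z B = Q then loss M q G B z else 0) =
      ∑ w ∈ Q, if w ∈ G \ clF M B ∧ insert w B = Q then loss M q G B w else 0 := by
    intro B _
    rw [← Finset.sum_filter, ← Finset.sum_filter]
    apply Finset.sum_congr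
    · ext w
      rw [Finset.mem_filter, Finset.mem_filter]
      constructor
      · rintro ⟨hw, h⟩
        exact ⟨by rw [← h]; exact Finset.mem_insert_self _ _, hw, h⟩
      · rintro ⟨-, hw, h⟩
        exact ⟨hw, h⟩
    · intro w _; rfl
  rw [Finset.sum_congr rfl hstep, Finset.sum_comm]
  apply Finset.sum_congr rfl
  intro w hw
  unfold faceLossP
  split_ifs with hcond
  · -- exactly the member `Q ∖ w` contributes
    rw [Finset.sum_eq_single (Q.erase w)]
    · rw [if_pos ⟨hcond.2.2, Finset.insert_erase hw⟩]
    · intro B hB hne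
      rw [if_neg]
      rintro ⟨hwB, h⟩
      apply hne
      rw [← h, Finset.erase_insert]
      exact notMem_of_notMem_clF (mem_membersIn.1 (mem_thinMembers.1 (Finset.mem_filter.1 hB).1).1).1
        (Finset.mem_sdiff.1 hwB).2
    · intro h
      exact absurd (Finset.mem_filter.2 ⟨hcond.1, hcond.2.1⟩) h
  · apply Finset.sum_eq_zero
    intro B hB
    rw [if_neg]
    rintro ⟨hwB, h⟩
    apply hcond
    have hwB' : w ∉ B := notMem_of_notMem_clF
      (mem_membersIn.1 (mem_thinMembers.1 (Finset.mem_filter.1 hB).1).1).1 (Finset.mem_sdiff.1 hwB).2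
    have hBQ : Q.erase w = B := by rw [← h, Finset.erase_insert hwB']
    rw [hBQ]
    exact ⟨(Finset.mem_filter.1 hB).1, (Finset.mem_filter.1 hB).2, hwB⟩

open scoped Classical in
/-- **The load of `S` through its faces**: `dload S ≤ Σ_{y ∈ X ∩ S} (Σ_{w ∈ S ∖ y} faceLossP (S ∖ y) w) / |X ∖ (S ∖ y)|`. -/
theorem dload_comp_le_sum_faceLossP (X S : Finset α) :
    dload M q G P (dshComp M q G X) S ≤
      ∑ y ∈ X ∩ S, (∑ w ∈ S.erase y, faceLossP M q G P (S.erase y) w) / ((X \ S.erase y).card : ℚ) := by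
  unfold dload
  have h1 : ∀ B ∈ (thinMembers M q G).filter P, ∑ z ∈ G \ clF M B, dshComp M q G X B z S =
      ∑ y ∈ X ∩ S, ∑ z ∈ G \ clF M B,
        (if insert z B = S.erase y then loss M q G B z else 0) / ((X \ S.erase y).card : ℚ) := by
    intro B _
    rw [Finset.sum_comm]
    apply Finset.sum_congr rfl
    intro z _
    rw [dshComp_eq_sum]
    apply Finset.sum_congr rfl
    intro y _
    split_ifs with h h' h'
    · rfl
    · exact absurd h.symm h'
    · exact absurd h'.symm h
    · rw [zero_div]
  rw [Finset.sum_congr rfl h1, Finset.sum_comm]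
  apply le_of_eq
  apply Finset.sum_congr rfl
  intro y _
  rw [← sum_loss_of_insert_eq, Finset.sum_div]
  apply Finset.sum_congr rfl
  intro B _
  rw [Finset.sum_div]

end CompLemmas

end PercRepro.Shadow
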